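import Mathlib
import HarnessLib
import Summits.Ventures.LatticeQCDFlow.Exactness.SampleESS

/-!
# Pooling never loses more than the worst block: `min_r ESS(block r) ≤ ESS(pooled)`

HONEST FRAMING: exact (Metropolis-corrected) sampling algorithms for lattice gauge theory;
figures of merit are autocorrelation/cost numbers at stated couplings and volumes; no
continuum-physics claim.

Venture `LatticeQCDFlow` (cell pub-lqcd), topic `Exactness`; FANOUT row 13 (`eng-snf`, GEN-25).
NEW WORK of the cell (elementary algebra) on the BUILT parent `Exactness/SampleESS` (`essHat`);
not a published result; no definition; nothing cited as a fact (Kish NAMED ONLY).  Companion of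
GEN-25 `NCMCGeneralSpaceKishPooling` (the CEILING `ESS(pooled) ≤ Σ_r ESS(block r)`); this file is
the FLOOR.

WHY (row 13).  The engine boards Kish fractions `essHat = (Σw)²/(N Σw²)` of the importance
weights `w = e^{−(W − max)}` at two resolutions: `ess_pooled = essHat(all weights)` and, per
block of a partition of the sample (topological sectors `Q = k` in `estimators.sector_weights`,
whose FITNESS number is `ess_per_sector_min = min_k ess_k`; streams / contiguous blocks in the
jackknife), the block fractions `ess_k`.  With block sums `a_r = Σ_j w_{rj} ≥ 0` and
`b_r = Σ_j w_{rj}² > 0`, if every block has Kish ESS COUNT `a_r²/b_r ≥ m` then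
`Σ_r b_r ≤ (Σ_r a_r²)/m ≤ (Σ_r a_r)²/m`, i.e.
**`ESS(pooled) = (Σ_r a_r)²/(Σ_r b_r) ≥ m = min_r ESS(block r)`**: the pooled sample never has
fewer effective samples than its worst block (and, by the companion file, never more than the
blocks together).  The statement is about the COUNT `N·essHat`; for the FRACTION `essHat` no such
floor holds — two blocks with perfectly even weights but different scales pool to a fraction
`< 1` (`essHat_pooled_lt_blocks_witness`: blocks `[1]`, `[3]`, each of fraction `1`, pool to
`[1, 3]` of fraction `4/5`).  So `ess_pooled` can lie BELOW `ess_per_sector_min`: the two boarded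
numbers are genuinely different diagnostics — the per-block minimum sees weight degeneracy INSIDE
a block, the pooled fraction also sees a scale mismatch BETWEEN individually even blocks
(sectors of very different weight, unequilibrated launches, a drifting reference).

* **`inf_sq_sum_div_le_sq_sum_sum_div`** — `min_r (Σ_j w_{rj})²/(Σ_j w_{rj}²) ≤ (ΣΣw)²/(ΣΣw²)`
  (nonnegative weights, every block carrying weight); `inf_sq_sum_div_le_sigma` — the same over
  the pooled index type `Σ r, J r`;
* **`inf_card_mul_essHat_le_sigma`** — `min_r n_r·essHat(w_r) ≤ N·essHat(pooled)`;
* `essHat_pooled_lt_blocks_witness` — the fraction has no such floor.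

NOT CLAIMED: anything about the population ESS (GEN-13/14); any floor for the fraction;
anything numerical.
-/

namespace Summit.Ventures.LatticeQCDFlow.Exactness.GeneralNCMC

open Finset Summit.Ventures.LatticeQCDFlow.Exactness

section Floor

variable {ι : Type*} [Fintype ι] [Nonempty ι] {J : ι → Type*} [∀ r, Fintype (J r)]

/-- **`min_r ESS(block r) ≤ ESS(pooled)`**: for blockwise NONNEGATIVE weights `w r : J r → ℝ`
with every block carrying weight (`Σ_j (w r j)² > 0`),
`min_r (Σ_j w_{rj})²/(Σ_j w_{rj}²) ≤ (Σ_r Σ_j w_{rj})²/(Σ_r Σ_j w_{rj}²)`. -/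
theorem inf_sq_sum_div_le_sq_sum_sum_div (w : (r : ι) → J r → ℝ) (hw : ∀ r j, 0 ≤ w r j)
    (hpos : ∀ r, 0 < ∑ j, w r j ^ 2) :
    univ.inf' univ_nonempty (fun r => (∑ j, w r j) ^ 2 / ∑ j, w r j ^ 2)
      ≤ (∑ r, ∑ j, w r j) ^ 2 / ∑ r, ∑ j, w r j ^ 2 := by
  set m := univ.inf' univ_nonempty (fun r => (∑ j, w r j) ^ 2 / ∑ j, w r j ^ 2) with hm
  have hB : 0 < ∑ r, ∑ j, w r j ^ 2 := sum_pos (fun r _ => hpos r) univ_nonempty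
  rw [le_div_iff₀ hB, mul_sum]
  -- blockwise: `m · b_r ≤ a_r²`
  have hblock : ∀ r, m * ∑ j, w r j ^ 2 ≤ (∑ j, w r j) ^ 2 := fun r => by
    rw [← le_div_iff₀ (hpos r)]
    exact inf'_le _ (mem_univ r)
  -- `Σ_r a_r² ≤ (Σ_r a_r)²` for the nonnegative block sums
  have hsq : ∑ r, (∑ j, w r j) ^ 2 ≤ (∑ r, ∑ j, w r j) ^ 2 :=
    sum_sq_le_sq_sum (fun r => ∑ j, w r j) fun r => sum_nonneg fun j _ => hw r j
  exact (sum_le_sum fun r _ => hblock r).trans hsq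

/-- The same with the pooled sums written over the pooled index type `Σ r, J r`. -/
theorem inf_sq_sum_div_le_sigma (w : (r : ι) → J r → ℝ) (hw : ∀ r j, 0 ≤ w r j)
    (hpos : ∀ r, 0 < ∑ j, w r j ^ 2) :
    univ.inf' univ_nonempty (fun r => (∑ j, w r j) ^ 2 / ∑ j, w r j ^ 2)
      ≤ (∑ p : (Σ r, J r), w p.1 p.2) ^ 2 / ∑ p : (Σ r, J r), w p.1 p.2 ^ 2 := by
  have h1 : (∑ p : (Σ r, J r), w p.1 p.2) = ∑ r, ∑ j, w r j := by
    rw [← Finset.univ_sigma_univ, Finset.sum_sigma]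
  have h2 : (∑ p : (Σ r, J r), w p.1 p.2 ^ 2) = ∑ r, ∑ j, w r j ^ 2 := by
    rw [← Finset.univ_sigma_univ, Finset.sum_sigma]
  rw [h1, h2]
  exact inf_sq_sum_div_le_sq_sum_sum_div w hw hpos

/-- `n · essHat v = (Σ v)²/Σ v²` (the Kish ESS count; restated privately — the companion file's
`card_mul_essHat_eq` has no object file yet). -/
private theorem card_mul_essHat_eq_aux {κ : Type*} [Fintype κ] (v : κ → ℝ)
    (hpos : 0 < ∑ j, v j ^ 2) (hcard : 0 < Fintype.card κ) :
    (Fintype.card κ : ℝ) * essHat v = (∑ j, v j) ^ 2 / ∑ j, v j ^ 2 := by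
  unfold essHat
  have hc : (Fintype.card κ : ℝ) ≠ 0 := by positivity
  field_simp

/-- **`min_r n_r · essHat(w_r) ≤ N · essHat(pooled)`** — in the boarded vocabulary
(`Exactness/SampleESS.essHat`, the Kish FRACTION; `n · essHat` is the Kish ESS count): the
pooled sample never has fewer effective samples than its worst block (nonnegative weights, every
block nonempty and carrying weight). -/
theorem inf_card_mul_essHat_le_sigma (w : (r : ι) → J r → ℝ) (hw : ∀ r j, 0 ≤ w r j)
    (hpos : ∀ r, 0 < ∑ j, w r j ^ 2) (hne : ∀ r, 0 < Fintype.card (J r)) :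
    univ.inf' univ_nonempty (fun r => (Fintype.card (J r) : ℝ) * essHat (w r))
      ≤ (Fintype.card (Σ r, J r) : ℝ) * essHat (fun p : (Σ r, J r) => w p.1 p.2) := by
  have hposS : 0 < ∑ p : (Σ r, J r), w p.1 p.2 ^ 2 := by
    rw [← Finset.univ_sigma_univ, Finset.sum_sigma]
    exact sum_pos (fun r _ => hpos r) univ_nonempty
  have hcardS : 0 < Fintype.card (Σ r, J r) := by
    rw [Fintype.card_sigma]
    exact sum_pos (fun r _ => hne r) univ_nonempty
  rw [card_mul_essHat_eq_aux _ hposS hcardS]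
  have hfun : (fun r => (Fintype.card (J r) : ℝ) * essHat (w r))
      = fun r => (∑ j, w r j) ^ 2 / ∑ j, w r j ^ 2 :=
    funext fun r => card_mul_essHat_eq_aux _ (hpos r) (hne r)
  rw [hfun]
  exact inf_sq_sum_div_le_sigma w hw hpos

end Floor

/-! ## No floor for the FRACTION: a scale mismatch between even blocks lowers `essHat(pooled)` -/

section Witness

/-- **The pooled Kish FRACTION can lie below every block fraction**: the one-point blocks `[1]`
and `[3]` each have `essHat = 1`, their pool `[1, 3]` has `essHat = 4/5 < 1`. -/
theorem essHat_pooled_lt_blocks_witness :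
    essHat ![(1 : ℝ)] = 1 ∧ essHat ![(3 : ℝ)] = 1 ∧ essHat ![(1 : ℝ), 3] = 4 / 5 ∧
      essHat ![(1 : ℝ), 3] < min (essHat ![(1 : ℝ)]) (essHat ![(3 : ℝ)]) := by
  have h1 : essHat ![(1 : ℝ)] = 1 := by
    simp [essHat]
  have h3 : essHat ![(3 : ℝ)] = 1 := by
    simp [essHat]
  have h13 : essHat ![(1 : ℝ), 3] = 4 / 5 := by
    simp [essHat, Fin.sum_univ_two]
    norm_num
  refine ⟨h1, h3, h13, ?_⟩
  rw [h1, h3, h13, min_self]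
  norm_num

end Witness

end Summit.Ventures.LatticeQCDFlow.Exactness.GeneralNCMC
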